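import Mathlib.Algebra.MvPolynomial.PDeriv
import Mathlib.Algebra.Polynomial.Derivative
import Literature.NumberTheory.DiophantineGeometry.BertiniShapeProofs
import HarnessLib

/-!
# Restriction of `f` to the generic line of direction `v`: `G(T) = f(Z + T v)`

For a field `E`, `f ∈ E[x₁, …, xₙ]` of total degree `δ` and a direction `v ∈ Eⁿ`, the
restriction of `f` to the line through the generic point `Z = (Z₁, …, Zₙ)` with direction `v`,
`G(T) = f(Z₁ + v₁ T, …, Zₙ + vₙ T) ∈ E[Z][T]`, is the auxiliary polynomial of Kaltofen's
effective Hilbert irreducibility theorem in the form used by Cafure–Matera (2006, §3.2: the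
discriminant `Res_T(G, ∂G/∂T) ∈ E[Z]` controls the base points `μ` for which `f(μ + T v)` is
separable). This file records its shape:

* `lineRestrict_eq_map_planeSubst`: `G` is obtained from `χ = f(0 + vX + Y·Z) ∈ E[Z][Y][X]`
  (`BertiniShapeProofs`) by setting `Y = 1`;
* `natDegree_lineRestrict_le`, `coeff_lineRestrict_totalDegree`,
  `totalDegree_coeff_lineRestrict_le`: `deg_T G ≤ δ`, the coefficient of `T^δ` is the constant
  `f_δ(v)`, and every `T`-coefficient has `Z`-degree `≤ δ`;
* `derivative_lineRestrict`: the chain rule `∂G/∂T = (Σᵢ vᵢ ∂ᵢf)(Z + T v)`;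
* `eq_zero_of_lineRestrict_eq_zero`: `P(Z + T v) = 0 → P = 0` (set `T = 0`);
* `map_eval_lineRestrict`: specializing `Z = μ` gives `g_μ(T) = f(μ + T v) ∈ E[T]`.

## References

* E. Kaltofen, J. Comput. System Sci. 50 (1995) 274–295, §3. [Kaltofen1995]
* A. Cafure, G. Matera, Finite Fields Appl. 12 (2006) 155–185, §3.2. [CafureMatera2006]
-/

noncomputable section

open scoped Classical Polynomial
open MvPolynomial

namespace Literature.NumberTheory.DiophantineGeometry

universe u

variable {E : Type u} [Field E] {n : ℕ}

/-! ### `G` as the specialization `Y = 1` of `χ₀ = f(vX + Y·Z)` -/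

/-- `G(T) = f(Z + Tv)` is `χ₀ = f(0 + vX + Y·Z)` with `Y = 1` (and `X = T`). [folklore] -/
theorem lineRestrict_eq_map_planeSubst (f : MvPolynomial (Fin n) E) (v : Fin n → E) :
    MvPolynomial.aeval (fun i ↦ Polynomial.C (X i) + Polynomial.C (C (v i)) * Polynomial.X :
        Fin n → Polynomial (MvPolynomial (Fin n) E)) f =
      (MvPolynomial.aeval (fun i ↦
        (Polynomial.C (Polynomial.C (MvPolynomial.C ((0 : Fin n → E) i))) +
          Polynomial.C (Polynomial.C (MvPolynomial.C (v i))) * Polynomial.X +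
          Polynomial.C (Polynomial.C (MvPolynomial.X i) * Polynomial.X) :
            Polynomial (Polynomial (MvPolynomial (Fin n) E)))) f).map
        (Polynomial.evalRingHom (1 : MvPolynomial (Fin n) E)) := by
  have h : (MvPolynomial.aeval (R := E)
      (fun i ↦ Polynomial.C (X i) + Polynomial.C (C (v i)) * Polynomial.X :
        Fin n → Polynomial (MvPolynomial (Fin n) E))).toRingHom =
      (Polynomial.mapRingHom (Polynomial.evalRingHom (1 : MvPolynomial (Fin n) E))).comp
        (MvPolynomial.aeval (R := E) (fun i ↦
          (Polynomial.C (Polynomial.C (MvPolynomial.C ((0 : Fin n → E) i))) +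
            Polynomial.C (Polynomial.C (MvPolynomial.C (v i))) * Polynomial.X +
            Polynomial.C (Polynomial.C (MvPolynomial.X i) * Polynomial.X) :
              Polynomial (Polynomial (MvPolynomial (Fin n) E))))).toRingHom := by
    refine MvPolynomial.ringHom_ext (fun e ↦ ?_) (fun i ↦ ?_)
    · simp [Polynomial.algebraMap_apply, MvPolynomial.algebraMap_eq]
    · simp only [AlgHom.toRingHom_eq_coe, RingHom.coe_coe, aeval_X, Pi.zero_apply, map_zero,
        zero_add, RingHom.coe_comp, Function.comp_apply, Polynomial.coe_mapRingHom,
        Polynomial.map_add, Polynomial.map_mul, Polynomial.map_C, Polynomial.coe_evalRingHom,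
        Polynomial.eval_C, Polynomial.map_X, Polynomial.eval_mul, Polynomial.eval_X, mul_one]
      ring
  exact congrArg (fun φ : MvPolynomial (Fin n) E →+* _ ↦ φ f) h

/-- **`deg_T G ≤ δ`.** [cite: CafureMatera2006, §3.2] -/
theorem natDegree_lineRestrict_le (f : MvPolynomial (Fin n) E) (v : Fin n → E) :
    (MvPolynomial.aeval (fun i ↦ Polynomial.C (X i) + Polynomial.C (C (v i)) * Polynomial.X :
        Fin n → Polynomial (MvPolynomial (Fin n) E)) f).natDegree ≤ f.totalDegree := by
  rw [lineRestrict_eq_map_planeSubst]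
  exact (Polynomial.natDegree_map_le).trans (natDegree_planeSubst_le f 0 v)

/-- **Top coefficient of `G`:** the coefficient of `T^δ` in `G` is the constant `f_δ(v)`.
[cite: CafureMatera2006, §3.2] -/
theorem coeff_lineRestrict_totalDegree (f : MvPolynomial (Fin n) E) (v : Fin n → E) :
    (MvPolynomial.aeval (fun i ↦ Polynomial.C (X i) + Polynomial.C (C (v i)) * Polynomial.X :
        Fin n → Polynomial (MvPolynomial (Fin n) E)) f).coeff f.totalDegree =
      C (MvPolynomial.eval v (homogeneousComponent f.totalDegree f)) := by
  rw [lineRestrict_eq_map_planeSubst, Polynomial.coeff_map, coeff_planeSubst_totalDegree,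
    Polynomial.coe_evalRingHom, Polynomial.eval_C]

/-- **`Z`-degree of the `T`-coefficients of `G`:** every coefficient of `G` has total degree
`≤ δ` in `Z`. [cite: CafureMatera2006, §3.2] -/
theorem totalDegree_coeff_lineRestrict_le (f : MvPolynomial (Fin n) E) (v : Fin n → E) (k : ℕ) :
    ((MvPolynomial.aeval (fun i ↦ Polynomial.C (X i) + Polynomial.C (C (v i)) * Polynomial.X :
        Fin n → Polynomial (MvPolynomial (Fin n) E)) f).coeff k).totalDegree ≤ f.totalDegree := by
  rw [lineRestrict_eq_map_planeSubst, Polynomial.coeff_map, Polynomial.coe_evalRingHom,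
    Polynomial.eval_eq_sum_range, Finset.sum_congr rfl fun j _ ↦ by rw [one_pow, mul_one]]
  refine totalDegree_finsetSum_le fun j hj ↦ ?_
  rw [Finset.mem_range] at hj
  by_cases hjk : f.totalDegree < j + k
  · rw [coeff_coeff_planeSubst_eq_zero f 0 v k j hjk, totalDegree_zero]
    exact Nat.zero_le _
  · exact (filtration_planeSubst f 0 v k j).trans (by omega)

/-! ### The chain rule `∂G/∂T = (D_v f)(Z + Tv)` -/

/-- **Chain rule along a line:** `d/dT f(Z + Tv) = (Σᵢ vᵢ ∂ᵢ f)(Z + Tv)`. [folklore] -/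
theorem derivative_lineRestrict (f : MvPolynomial (Fin n) E) (v : Fin n → E) :
    Polynomial.derivative (MvPolynomial.aeval
        (fun i ↦ Polynomial.C (X i) + Polynomial.C (C (v i)) * Polynomial.X :
          Fin n → Polynomial (MvPolynomial (Fin n) E)) f) =
      MvPolynomial.aeval
        (fun i ↦ Polynomial.C (X i) + Polynomial.C (C (v i)) * Polynomial.X :
          Fin n → Polynomial (MvPolynomial (Fin n) E)) (∑ i, C (v i) * pderiv i f) := by
  induction f using MvPolynomial.induction_on with
  | C a =>
    simp only [pderiv_C, mul_zero, Finset.sum_const_zero, map_zero]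
    rw [MvPolynomial.aeval_C, Polynomial.algebraMap_apply, Polynomial.derivative_C]
  | add p q hp hq =>
    simp only [map_add, hp, hq, mul_add, Finset.sum_add_distrib]
  | mul_X p i hp =>
    set θ : Fin n → Polynomial (MvPolynomial (Fin n) E) :=
      fun i ↦ Polynomial.C (X i) + Polynomial.C (C (v i)) * Polynomial.X with hθdef
    have hsum : (∑ j, C (v j) * pderiv j (p * X i)) =
        (∑ j, C (v j) * pderiv j p) * X i + C (v i) * p := by
      simp only [pderiv_mul, mul_add, Finset.sum_add_distrib, Finset.sum_mul]
      congr 1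
      · exact Finset.sum_congr rfl fun j _ ↦ by ring
      · rw [Finset.sum_eq_single i, pderiv_X_self, mul_one]
        · intro j _ hji
          rw [pderiv_X_of_ne (Ne.symm hji), mul_zero, mul_zero]
        · intro hi
          exact absurd (Finset.mem_univ i) hi
    have hθ : Polynomial.derivative (θ i) = Polynomial.C (C (v i)) := by
      rw [hθdef, Polynomial.derivative_add, Polynomial.derivative_C,
        Polynomial.derivative_C_mul_X, zero_add]
    rw [hsum, map_add, map_mul (MvPolynomial.aeval θ), map_mul (MvPolynomial.aeval θ),
      map_mul (MvPolynomial.aeval θ), aeval_X, aeval_C, ← hp, Polynomial.derivative_mul, hθ,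
      Polynomial.algebraMap_apply, MvPolynomial.algebraMap_eq]
    ring

/-- **`P(Z + Tv) = 0` forces `P = 0`** (set `T = 0`). [folklore] -/
theorem eq_zero_of_lineRestrict_eq_zero {P : MvPolynomial (Fin n) E} (v : Fin n → E)
    (hP : MvPolynomial.aeval
      (fun i ↦ Polynomial.C (X i) + Polynomial.C (C (v i)) * Polynomial.X :
        Fin n → Polynomial (MvPolynomial (Fin n) E)) P = 0) : P = 0 := by
  have h : (Polynomial.evalRingHom (0 : MvPolynomial (Fin n) E)).comp
      (MvPolynomial.aeval (R := E)
        (fun i ↦ Polynomial.C (X i) + Polynomial.C (C (v i)) * Polynomial.X :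
          Fin n → Polynomial (MvPolynomial (Fin n) E))).toRingHom =
      RingHom.id (MvPolynomial (Fin n) E) := by
    refine MvPolynomial.ringHom_ext (fun e ↦ ?_) (fun i ↦ ?_)
    · simp [Polynomial.algebraMap_apply, MvPolynomial.algebraMap_eq]
    · simp
  have := congrArg (fun φ : MvPolynomial (Fin n) E →+* MvPolynomial (Fin n) E ↦ φ P) h
  simp only [RingHom.coe_comp, Function.comp_apply, AlgHom.toRingHom_eq_coe, RingHom.coe_coe,
    RingHom.id_apply] at this
  rw [← this, hP, map_zero]

/-- **`∂G/∂T = 0` forces `D_v f = 0`.** [folklore] -/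
theorem sum_C_mul_pderiv_eq_zero_of_derivative_lineRestrict {f : MvPolynomial (Fin n) E}
    (v : Fin n → E) (h : Polynomial.derivative (MvPolynomial.aeval
      (fun i ↦ Polynomial.C (X i) + Polynomial.C (C (v i)) * Polynomial.X :
        Fin n → Polynomial (MvPolynomial (Fin n) E)) f) = 0) :
    (∑ i, C (v i) * pderiv i f) = 0 := by
  rw [derivative_lineRestrict] at h
  exact eq_zero_of_lineRestrict_eq_zero v h

/-! ### Specializing the base point: `g_μ(T) = f(μ + Tv)` -/

/-- **Specialization `Z = μ`:** `G(Z := μ) = g_μ = f(μ + Tv) ∈ E[T]`. [folklore] -/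
theorem map_eval_lineRestrict (f : MvPolynomial (Fin n) E) (μ v : Fin n → E) :
    (MvPolynomial.aeval (fun i ↦ Polynomial.C (X i) + Polynomial.C (C (v i)) * Polynomial.X :
        Fin n → Polynomial (MvPolynomial (Fin n) E)) f).map (MvPolynomial.eval μ) =
      MvPolynomial.aeval (fun i ↦ Polynomial.C (μ i) + Polynomial.C (v i) * Polynomial.X :
        Fin n → E[X]) f := by
  have h : (Polynomial.mapRingHom (MvPolynomial.eval μ)).comp (MvPolynomial.aeval (R := E)
      (fun i ↦ Polynomial.C (X i) + Polynomial.C (C (v i)) * Polynomial.X :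
        Fin n → Polynomial (MvPolynomial (Fin n) E))).toRingHom =
      (MvPolynomial.aeval (R := E)
        (fun i ↦ Polynomial.C (μ i) + Polynomial.C (v i) * Polynomial.X :
          Fin n → E[X])).toRingHom := by
    refine MvPolynomial.ringHom_ext (fun e ↦ ?_) (fun i ↦ ?_)
    · simp [Polynomial.algebraMap_apply, MvPolynomial.algebraMap_eq]
    · simp
  exact congrArg (fun φ : MvPolynomial (Fin n) E →+* _ ↦ φ f) h

/-- **Derivative of the specialization:** `g_μ' = (D_v f)(μ + Tv)`. [folklore] -/
theorem derivative_map_eval_lineRestrict (f : MvPolynomial (Fin n) E) (μ v : Fin n → E) :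
    Polynomial.derivative (MvPolynomial.aeval
        (fun i ↦ Polynomial.C (μ i) + Polynomial.C (v i) * Polynomial.X : Fin n → E[X]) f) =
      MvPolynomial.aeval
        (fun i ↦ Polynomial.C (μ i) + Polynomial.C (v i) * Polynomial.X : Fin n → E[X])
        (∑ i, C (v i) * pderiv i f) := by
  rw [← map_eval_lineRestrict, Polynomial.derivative_map, derivative_lineRestrict,
    map_eval_lineRestrict]

/-- **Degree and top coefficient of `g_μ`:** `deg g_μ ≤ δ` and its `T^δ`-coefficient is
`f_δ(v)`. [cite: CafureMatera2006, §3.2] -/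
theorem natDegree_map_eval_lineRestrict_le (f : MvPolynomial (Fin n) E) (μ v : Fin n → E) :
    (MvPolynomial.aeval
      (fun i ↦ Polynomial.C (μ i) + Polynomial.C (v i) * Polynomial.X : Fin n → E[X])
        f).natDegree ≤ f.totalDegree := by
  rw [← map_eval_lineRestrict]
  exact (Polynomial.natDegree_map_le).trans (natDegree_lineRestrict_le f v)

/-- The `T^δ`-coefficient of `g_μ = f(μ + Tv)` is `f_δ(v)`. [cite: CafureMatera2006, §3.2] -/
theorem coeff_map_eval_lineRestrict_totalDegree (f : MvPolynomial (Fin n) E) (μ v : Fin n → E) :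
    (MvPolynomial.aeval
      (fun i ↦ Polynomial.C (μ i) + Polynomial.C (v i) * Polynomial.X : Fin n → E[X])
        f).coeff f.totalDegree = MvPolynomial.eval v (homogeneousComponent f.totalDegree f) := by
  rw [← map_eval_lineRestrict, Polynomial.coeff_map, coeff_lineRestrict_totalDegree, eval_C]

end Literature.NumberTheory.DiophantineGeometry
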